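import Summits.AtomisticToContinuum.FouriersLaw.Theorems.PhononMeanFreePathIncoherentChannelHarmonicDissipation
import Summits.AtomisticToContinuum.FouriersLaw.Theorems.PhononMeanFreePathIncoherentChannelOneTimeCorner
import Summits.AtomisticToContinuum.FouriersLaw.Theorems.PhononMeanFreePathHarmonicCoherentPersistence

/-!
# `IncoherentChannel`, line `two-horizons-forecast-loss` — the harmonic tail budget, the exact forecast sum rule, and the
calibration of the ONE-TIME engine at the harmonic corner

Helper file (lead c6, cycle 1) for the ENGINE stub `stub_forecastLoss` of crux `PhononMeanFreePath.IncoherentChannel`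
(item stmt-AtomisticToContinuum-11811), continuing `…HarmonicDissipation.lean` (the identity
`dS_N/dt = -(2γ/T)(r_N² + a_N²)` at `lam = β = 0` and its integrated form). Here:

* `harmonic_forecastBudget_tail` — **HARMONIC TAIL BUDGET** `(2γ/T)∫_{t>t₁}(r_N² + a_N²) ≤ S_N(t₁)` for every `N`, `t₁ ≥ 0`,
  with integrability on `(t₁, ∞)` (the corner case the landed `forecastBudget_tail`, p148747, does not cover);
* `harmonic_fnorm_tendsto_zero` — LaSalle: `S_N(t) → 0` as `t → ∞` at fixed `N` (the free damped flow relaxes to `0`;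
  dominated convergence with the energy as majorant);
* `harmonic_forecastBudget_eq`, `harmonic_forecast_sumRule` — hence EQUALITY: `S_N(t₁) = (2γ/T)∫_{t>t₁}(r_N² + a_N²)` and
  **`∫₀^∞ (r_N² + a_N²) = T²/(2γ)` for EVERY `N`** — the landed `N`-uniform forecast budget `≤ T²/(2γ)` (p135026) is SATURATED at
  the harmonic corner: all of the forecast norm is eventually spent as coherent budget, nothing is lost incoherently;
* `oneTime_false_harmonic` — **CALIBRATION OF THE ONE-TIME ENGINE**: at `lam = β = 0`, for every `η ∈ (0,1)`,
  `¬ (N·S_N(N^η) → 0)`; indeed by the corner-capable composition `oneTime_coherent_of_tailBudget_of_nonneg` (W-D: corner light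
  cone `lightConeH_of_nonneg` + the harmonic tail budget) it would give `N∫₀^∞ r_N² → 0`, refuted by
  `harmonicCoherentPersistence_proof` (Rieder–Lebowitz–Lieb ballistic conductance). So the weakest registered form of the
  line's engine (p149873) genuinely uses anharmonicity, exactly like the envelope form (`forecastLossEnvelope_false_harmonic`,
  p93738): its hypothesis is what fails at the corner (the escaped fraction of the forecast norm does not return in time `N^η`).

Registered closed forms: `harmonic_forecastBudget_tail_closed`, `harmonic_forecast_sumRule_closed`, `oneTime_false_harmonic`.
No definitions; nothing here closes an item.
-/

noncomputable section

namespace Summit.AtomisticToContinuum.FouriersLaw.Theorems.PhononMeanFreePath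

open MeasureTheory Set Filter Topology
open scoped NNReal
open Literature.MathematicalPhysics.KineticTheory.HeatConduction

section Harmonic

variable {ω₂ γ T : ℝ} (hω : 0 < ω₂) (hγ : 0 < γ) (hT : 0 < T)
include hω hγ hT

/-! ### The harmonic tail budget, the LaSalle limit, and the exact forecast sum rule -/

/-- **HARMONIC TAIL BUDGET** (the corner case the landed `forecastBudget_tail`, p148747, does not cover — that one needs
`β > 0`): for the pinned harmonic chain, every `N` and `t₁ ≥ 0`, `t ↦ r_N(t)² + a_N(t)²` is integrable on `(t₁, ∞)` and
`(2γ/T) ∫_{t > t₁} (r_N² + a_N²) ≤ S_N(t₁)`. [folklore] -/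
theorem harmonic_forecastBudget_tail (N : ℕ) {t₁ : ℝ} (ht₁ : 0 ≤ t₁) :
    IntegrableOn (fun s => (pairCorr ω₂ 0 0 γ T N s) ^ 2 +
        (∫ z, z.2 (Fin.last N) * fcast ω₂ 0 0 γ T N s z ∂((pinnedChain ω₂ 0 0 γ).gibbsMeasure (N + 1) T)) ^ 2) (Ioi t₁) ∧
    (2 * γ / T) * ∫ s in Ioi t₁, ((pairCorr ω₂ 0 0 γ T N s) ^ 2 +
        (∫ z, z.2 (Fin.last N) * fcast ω₂ 0 0 γ T N s z ∂((pinnedChain ω₂ 0 0 γ).gibbsMeasure (N + 1) T)) ^ 2) ≤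
      fnorm ω₂ 0 0 γ T N t₁ := by
  set g : ℝ → ℝ := fun s => (pairCorr ω₂ 0 0 γ T N s) ^ 2 +
      (∫ z, z.2 (Fin.last N) * fcast ω₂ 0 0 γ T N s z ∂((pinnedChain ω₂ 0 0 γ).gibbsMeasure (N + 1) T)) ^ 2 with hg
  have hgc : Continuous g :=
    ((harmonic_pairCorr_continuous hω hγ hT N).pow 2).add ((harmonic_endAutocorr_continuous hω hγ hT N).pow 2)
  have hg0 : ∀ s, 0 ≤ g s := fun s => add_nonneg (sq_nonneg _) (sq_nonneg _)
  have hγT : 0 < 2 * γ / T := by positivity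
  set I : ℝ := T / (2 * γ) * fnorm ω₂ 0 0 γ T N t₁ with hI
  -- the interval integrals are bounded by `I`
  have hbound : ∀ t₂, t₁ ≤ t₂ → ∫ s in t₁..t₂, g s ≤ I := by
    intro t₂ h12
    have h : fnorm ω₂ 0 0 γ T N t₁ - fnorm ω₂ 0 0 γ T N t₂ = (2 * γ / T) * ∫ s in t₁..t₂, g s :=
      harmonic_fnorm_sub_eq_integral hω hγ hT N ht₁ h12
    have hS2 : 0 ≤ fnorm ω₂ 0 0 γ T N t₂ := fnorm_nonneg ω₂ 0 0 γ T N t₂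
    have e : ∫ s in t₁..t₂, g s = T / (2 * γ) * (fnorm ω₂ 0 0 γ T N t₁ - fnorm ω₂ 0 0 γ T N t₂) := by
      rw [h]; field_simp
    rw [e, hI]
    exact mul_le_mul_of_nonneg_left (by linarith) (by positivity)
  have hfi : ∀ t₂ : ℝ, IntegrableOn g (Ioc t₁ t₂) := fun t₂ =>
    (hgc.integrableOn_Icc).mono_set Ioc_subset_Icc_self
  have hnorm : ∀ᶠ t₂ : ℝ in atTop, ∫ s in t₁..id t₂, ‖g s‖ ≤ I := by
    filter_upwards [eventually_ge_atTop t₁] with t₂ h12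
    have e : ∫ s in t₁..t₂, ‖g s‖ = ∫ s in t₁..t₂, g s :=
      intervalIntegral.integral_congr fun s _ => Real.norm_of_nonneg (hg0 s)
    rw [id, e]
    exact hbound t₂ h12
  have hInt : IntegrableOn g (Ioi t₁) :=
    integrableOn_Ioi_of_intervalIntegral_norm_bounded I t₁ hfi tendsto_id hnorm
  refine ⟨hInt, ?_⟩
  have hlim := intervalIntegral_tendsto_integral_Ioi t₁ hInt tendsto_id
  have hle : ∫ s in Ioi t₁, g s ≤ I :=
    le_of_tendsto hlim (by filter_upwards [eventually_ge_atTop t₁] with t₂ h12 using hbound t₂ h12)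
  calc (2 * γ / T) * ∫ s in Ioi t₁, g s ≤ (2 * γ / T) * I := mul_le_mul_of_nonneg_left hle hγT.le
    _ = fnorm ω₂ 0 0 γ T N t₁ := by rw [hI]; field_simp

omit hγ in
/-- The Hamiltonian is Gibbs-integrable (domination by `2T·e^{H/(2T)}`). [folklore] -/
theorem harmonic_integrable_hamiltonian (n : ℕ) :
    Integrable ((pinnedChain ω₂ 0 0 γ).hamiltonian n) ((pinnedChain ω₂ 0 0 γ).gibbsMeasure n T) := by
  have hs : (1 / (2 * T)) < 1 / T := by
    rw [div_lt_div_iff_of_pos_left one_pos (by positivity) hT]; linarith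
  have hexp := pinnedChain_integrable_exp_mul_hamiltonian_gibbsMeasure hω le_rfl le_rfl γ n hT hs
  have hHc := pinnedChain_continuous_hamiltonian ω₂ 0 0 γ n
  refine (hexp.const_mul (2 * T)).mono' hHc.aestronglyMeasurable (ae_of_all _ fun x => ?_)
  have hH0 : 0 ≤ (pinnedChain ω₂ 0 0 γ).hamiltonian n x := pinnedChain_hamiltonian_nonneg hω.le le_rfl le_rfl γ n x
  rw [Real.norm_eq_abs, abs_of_nonneg hH0]
  set y : ℝ := 1 / (2 * T) * (pinnedChain ω₂ 0 0 γ).hamiltonian n x with hy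
  have h1 := Real.add_one_le_exp y
  have h2 : (pinnedChain ω₂ 0 0 γ).hamiltonian n x = 2 * T * y := by
    rw [hy]; field_simp
  rw [h2]
  exact mul_le_mul_of_nonneg_left (by linarith) (by positivity)

/-- **LaSalle for the forecast norm**: `S_N(t) → 0` as `t → ∞` at fixed `N` (the free damped flow relaxes to `0`,
dominated convergence with the energy as majorant). [folklore] -/
theorem harmonic_fnorm_tendsto_zero (N : ℕ) : Tendsto (fun t => fnorm ω₂ 0 0 γ T N t) atTop (𝓝 0) := by
  set P := pinnedChain ω₂ 0 0 γ with hP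
  set μ := P.gibbsMeasure (N + 1) T with hμ
  set ℓ : Fin (N + 1) := Fin.last N with hℓ
  have hfun : (fun s => fnorm ω₂ 0 0 γ T N s) = fun s => ∫ z, ((P.chainFlow (N + 1) z 0 s).2 ℓ) ^ 2 ∂μ :=
    funext fun s => harmonic_fnorm_eq_integral_freeFlow hω hγ hT N s
  rw [hfun]
  set c : ℝ := 2 * max ω₂⁻¹ 1 with hc
  have hc0 : 0 ≤ c := by positivity
  have h0 : (∫ z, (fun _ => (0 : ℝ)) z ∂μ) = 0 := by simp
  rw [← h0]
  refine tendsto_integral_filter_of_dominated_convergence (fun z => c * P.hamiltonian (N + 1) z) ?_ ?_ ?_ ?_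
  · refine Eventually.of_forall fun t => ?_
    obtain ⟨L, hL⟩ := harmonic_exists_clm_freeFlow_snd hω hγ.le (N + 1) t ℓ
    have e : (fun z => ((P.chainFlow (N + 1) z 0 t).2 ℓ) ^ 2) = fun z => (L z) ^ 2 := funext fun z => by rw [hL z]
    rw [e]
    exact (L.continuous.pow 2).aestronglyMeasurable
  · refine Eventually.of_forall fun t => ae_of_all _ fun z => ?_
    have h1 : |(P.chainFlow (N + 1) z 0 t).2 ℓ| ≤ ‖P.chainFlow (N + 1) z 0 t‖ :=
      OscillatorChain.abs_snd_apply_le_norm _ ℓ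
    have h2 := Summit.AtomisticToContinuum.FouriersLaw.Theorems.IncoherentChannel.Negative.KernelMoments.norm_sq_le_mul_hamiltonian
      hω le_rfl le_rfl γ (P.chainFlow (N + 1) z 0 t)
    have h3 := pinnedChain_hamiltonian_freeFlow_le hω le_rfl le_rfl hγ.le (N + 1) z t
    rw [Real.norm_eq_abs, abs_of_nonneg (sq_nonneg _), ← sq_abs]
    calc |(P.chainFlow (N + 1) z 0 t).2 ℓ| ^ 2 ≤ ‖P.chainFlow (N + 1) z 0 t‖ ^ 2 :=
          pow_le_pow_left₀ (abs_nonneg _) h1 2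
      _ ≤ c * P.hamiltonian (N + 1) (P.chainFlow (N + 1) z 0 t) := h2
      _ ≤ c * P.hamiltonian (N + 1) z := mul_le_mul_of_nonneg_left h3 hc0
  · exact (harmonic_integrable_hamiltonian hω hT (N + 1)).const_mul c
  · refine ae_of_all _ fun z => ?_
    have hflow := pinnedChain_tendsto_freeFlow_zero hω le_rfl le_rfl hγ (Nat.succ_pos N) z
    have hcont : Continuous fun x : PhaseSpace (N + 1) => (x.2 ℓ) ^ 2 := by fun_prop
    have h2 : Tendsto (fun t => ((P.chainFlow (N + 1) z 0 t).2 ℓ) ^ 2) atTop (𝓝 (((0 : PhaseSpace (N + 1)).2 ℓ) ^ 2)) :=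
      (hcont.tendsto 0).comp hflow
    simpa using h2

/-- **THE EXACT HARMONIC FORECAST BUDGET**: `S_N(t₁) = (2γ/T) ∫_{t > t₁} (r_N² + a_N²)` for every `N`, `t₁ ≥ 0` —
at the harmonic corner ALL of the forecast norm is eventually spent as coherent budget (no incoherent loss).
[folklore] -/
theorem harmonic_forecastBudget_eq (N : ℕ) {t₁ : ℝ} (ht₁ : 0 ≤ t₁) :
    fnorm ω₂ 0 0 γ T N t₁ = (2 * γ / T) * ∫ s in Ioi t₁, ((pairCorr ω₂ 0 0 γ T N s) ^ 2 +
        (∫ z, z.2 (Fin.last N) * fcast ω₂ 0 0 γ T N s z ∂((pinnedChain ω₂ 0 0 γ).gibbsMeasure (N + 1) T)) ^ 2) := by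
  set g : ℝ → ℝ := fun s => (pairCorr ω₂ 0 0 γ T N s) ^ 2 +
      (∫ z, z.2 (Fin.last N) * fcast ω₂ 0 0 γ T N s z ∂((pinnedChain ω₂ 0 0 γ).gibbsMeasure (N + 1) T)) ^ 2 with hg
  have hInt := (harmonic_forecastBudget_tail hω hγ hT N ht₁).1
  have hlim := intervalIntegral_tendsto_integral_Ioi t₁ hInt tendsto_id
  -- the interval integrals tend to `(T/2γ)·S_N(t₁)`
  have hlim' : Tendsto (fun t₂ : ℝ => ∫ s in t₁..id t₂, g s) atTop (𝓝 (T / (2 * γ) * fnorm ω₂ 0 0 γ T N t₁)) := by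
    have h1 : Tendsto (fun t₂ : ℝ => T / (2 * γ) * (fnorm ω₂ 0 0 γ T N t₁ - fnorm ω₂ 0 0 γ T N t₂)) atTop
        (𝓝 (T / (2 * γ) * (fnorm ω₂ 0 0 γ T N t₁ - 0))) :=
      (tendsto_const_nhds.sub (harmonic_fnorm_tendsto_zero hω hγ hT N)).const_mul _
    rw [sub_zero] at h1
    refine h1.congr' ?_
    filter_upwards [eventually_ge_atTop t₁] with t₂ h12
    have h : fnorm ω₂ 0 0 γ T N t₁ - fnorm ω₂ 0 0 γ T N t₂ = (2 * γ / T) * ∫ s in t₁..t₂, g s :=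
      harmonic_fnorm_sub_eq_integral hω hγ hT N ht₁ h12
    rw [h, id]
    field_simp
  have heq := tendsto_nhds_unique hlim hlim'
  rw [heq]
  field_simp

/-- **THE EXACT FORECAST SUM RULE AT THE HARMONIC CORNER**: `∫₀^∞ (r_N(t)² + a_N(t)²) dt = T²/(2γ)` for EVERY `N` —
equality in the landed `N`-uniform forecast budget `≤ T²/(2γ)` (p135026). [folklore] -/
theorem harmonic_forecast_sumRule (N : ℕ) :
    ∫ s in Ioi (0 : ℝ), ((pairCorr ω₂ 0 0 γ T N s) ^ 2 +
        (∫ z, z.2 (Fin.last N) * fcast ω₂ 0 0 γ T N s z ∂((pinnedChain ω₂ 0 0 γ).gibbsMeasure (N + 1) T)) ^ 2) =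
      T ^ 2 / (2 * γ) := by
  have h := harmonic_forecastBudget_eq hω hγ hT N le_rfl
  have h0 : fnorm ω₂ 0 0 γ T N 0 = T := by
    rw [harmonic_fnorm_eq_integral_freeFlow hω hγ hT N 0]
    simp only [pinnedChain_freeFlow_zero]
    exact Summit.AtomisticToContinuum.FouriersLaw.Theorems.IncoherentChannel.Negative.GibbsStein.gibbs_sq_momentum
      hω le_rfl le_rfl hT (Fin.last N)
  rw [h0] at h
  have hγT : (2 * γ / T) ≠ 0 := by positivity
  field_simp at h
  field_simp
  linarith

omit hω hγ hT in
/-- **Registered closed form (`harmonic_forecastBudget_tail_closed`): the harmonic tail budget** — same shape as the landed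
`forecastBudget_tail` (p148747) but at `lam = β = 0`. [folklore] -/
theorem harmonic_forecastBudget_tail_closed : ∀ ω₂ γ : ℝ, 0 < ω₂ → 0 < γ → ∀ T : ℝ, 0 < T → ∀ (N : ℕ) (t₁ : ℝ), 0 ≤ t₁ → (2 * γ / T) * ∫ s in Ioi t₁, ((pairCorr ω₂ 0 0 γ T N s) ^ 2 + (∫ z, z.2 (Fin.last N) * fcast ω₂ 0 0 γ T N s z ∂((pinnedChain ω₂ 0 0 γ).gibbsMeasure (N + 1) T)) ^ 2) ≤ fnorm ω₂ 0 0 γ T N t₁ :=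
  fun _ _ hω hγ _ hT N _ ht₁ => (harmonic_forecastBudget_tail hω hγ hT N ht₁).2

omit hω hγ hT in
/-- **Registered closed form (`harmonic_forecast_sumRule_closed`): the exact forecast sum rule at the harmonic corner**,
`∫₀^∞ (r_N² + a_N²) = T²/(2γ)` for every `N`. [folklore] -/
theorem harmonic_forecast_sumRule_closed : ∀ ω₂ γ : ℝ, 0 < ω₂ → 0 < γ → ∀ T : ℝ, 0 < T → ∀ N : ℕ, ∫ s in Ioi (0 : ℝ), ((pairCorr ω₂ 0 0 γ T N s) ^ 2 + (∫ z, z.2 (Fin.last N) * fcast ω₂ 0 0 γ T N s z ∂((pinnedChain ω₂ 0 0 γ).gibbsMeasure (N + 1) T)) ^ 2) = T ^ 2 / (2 * γ) :=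
  fun _ _ hω hγ _ hT N => harmonic_forecast_sumRule hω hγ hT N

/-! ### The quantitative harmonic plateau: the ballistically transmitted fraction of the forecast norm never returns -/

/-- **Echo re-absorption at the harmonic corner**: `∫₀^∞ a_N² = T²/(2γ) - T²·c_{N+1}/(2γ²)` for `N ≥ 1` — the unit forecast budget
splits EXACTLY into the transmitted part (the Rieder–Lebowitz–Lieb conductance `c_{N+1} = fluxCoeff ω₂ γ (N+1)`, carried by `r_N`)
and the echo re-absorbed at the same bath (carried by `a_N`); nothing is dephased. [folklore] -/
theorem harmonic_integral_endAutocorr_sq {N : ℕ} (hN : 1 ≤ N) :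
    ∫ s in Ioi (0 : ℝ), (∫ z, z.2 (Fin.last N) * fcast ω₂ 0 0 γ T N s z ∂((pinnedChain ω₂ 0 0 γ).gibbsMeasure (N + 1) T)) ^ 2 =
      T ^ 2 / (2 * γ) - T ^ 2 * fluxCoeff ω₂ γ (N + 1) / (2 * γ ^ 2) := by
  have hP := Summit.AtomisticToContinuum.FouriersLaw.Theorems.HarmonicCoherentPersistence.harmonicCoherentPersistence_proof
    ω₂ γ hω hγ T hT
  have hr : IntegrableOn (fun s => (pairCorr ω₂ 0 0 γ T N s) ^ 2) (Ioi (0 : ℝ)) := hP.1 N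
  have hsum := (harmonic_forecastBudget_tail hω hγ hT N le_rfl).1
  have ha : IntegrableOn (fun s => (∫ z, z.2 (Fin.last N) * fcast ω₂ 0 0 γ T N s z
      ∂((pinnedChain ω₂ 0 0 γ).gibbsMeasure (N + 1) T)) ^ 2) (Ioi (0 : ℝ)) := by
    have := hsum.sub hr
    refine this.congr_fun (fun s _ => ?_) measurableSet_Ioi
    simp only [Pi.sub_apply]; ring
  have htot := harmonic_forecast_sumRule hω hγ hT N
  rw [integral_add hr ha] at htot
  have hrv : ∫ s in Ioi (0 : ℝ), (pairCorr ω₂ 0 0 γ T N s) ^ 2 = T ^ 2 * fluxCoeff ω₂ γ (N + 1) / (2 * γ ^ 2) :=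
    Summit.AtomisticToContinuum.FouriersLaw.Theorems.HarmonicCoherentPersistence.harmonic_integral_pairCorr_sq hω hγ hT hN
  linarith

/-- **The forecast norm is bounded below by the transmission not yet arrived**: for `N ≥ 1` and `t ≥ 0`,
`S_N(t) ≥ T·c_{N+1}/γ - (2γ/T)∫₀ᵗ r_N²` (exact budget `S_N(t) = (2γ/T)∫_{s>t}(r_N² + a_N²) ≥ (2γ/T)∫_{s>t} r_N²`, and
`(2γ/T)∫₀^∞ r_N² = T·c_{N+1}/γ`). [folklore] -/
theorem harmonic_fnorm_ge_transmission {N : ℕ} (hN : 1 ≤ N) {t : ℝ} (ht : 0 ≤ t) :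
    T * fluxCoeff ω₂ γ (N + 1) / γ - (2 * γ / T) * ∫ s in Ioc 0 t, (pairCorr ω₂ 0 0 γ T N s) ^ 2 ≤ fnorm ω₂ 0 0 γ T N t := by
  have hP := Summit.AtomisticToContinuum.FouriersLaw.Theorems.HarmonicCoherentPersistence.harmonicCoherentPersistence_proof
    ω₂ γ hω hγ T hT
  have hr : IntegrableOn (fun s => (pairCorr ω₂ 0 0 γ T N s) ^ 2) (Ioi (0 : ℝ)) := hP.1 N
  have hrv : ∫ s in Ioi (0 : ℝ), (pairCorr ω₂ 0 0 γ T N s) ^ 2 = T ^ 2 * fluxCoeff ω₂ γ (N + 1) / (2 * γ ^ 2) :=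
    Summit.AtomisticToContinuum.FouriersLaw.Theorems.HarmonicCoherentPersistence.harmonic_integral_pairCorr_sq hω hγ hT hN
  -- split `(0,∞)` at `t`
  have hsplit : ∫ s in Ioi (0 : ℝ), (pairCorr ω₂ 0 0 γ T N s) ^ 2 =
      (∫ s in Ioc 0 t, (pairCorr ω₂ 0 0 γ T N s) ^ 2) + ∫ s in Ioi t, (pairCorr ω₂ 0 0 γ T N s) ^ 2 := by
    rw [← setIntegral_union Ioc_disjoint_Ioi_same measurableSet_Ioi (hr.mono_set Ioc_subset_Ioi_self)
      (hr.mono_set (Ioi_subset_Ioi ht)), Ioc_union_Ioi_eq_Ioi ht]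
  -- the tail of `r²` is budgeted by `S_N(t)`
  obtain ⟨hInt, hle⟩ := harmonic_forecastBudget_tail hω hγ hT N ht
  have hmono : ∫ s in Ioi t, (pairCorr ω₂ 0 0 γ T N s) ^ 2 ≤ ∫ s in Ioi t, ((pairCorr ω₂ 0 0 γ T N s) ^ 2 +
      (∫ z, z.2 (Fin.last N) * fcast ω₂ 0 0 γ T N s z ∂((pinnedChain ω₂ 0 0 γ).gibbsMeasure (N + 1) T)) ^ 2) :=
    integral_mono (hr.mono_set (Ioi_subset_Ioi ht)) hInt fun s => le_add_of_nonneg_right (sq_nonneg _)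
  have hγT : 0 ≤ 2 * γ / T := by positivity
  have htail : (2 * γ / T) * ∫ s in Ioi t, (pairCorr ω₂ 0 0 γ T N s) ^ 2 ≤ fnorm ω₂ 0 0 γ T N t :=
    (mul_le_mul_of_nonneg_left hmono hγT).trans hle
  have e : T * fluxCoeff ω₂ γ (N + 1) / γ = (2 * γ / T) * ∫ s in Ioi (0 : ℝ), (pairCorr ω₂ 0 0 γ T N s) ^ 2 := by
    rw [hrv]; field_simp
  rw [e, hsplit, mul_add]
  linarith

omit hω hγ hT in
/-- Powers of `N`: `N^η ε_N → 0` whenever `N^{1+η} ε_N → 0` and `ε_N ≥ 0` eventually. [folklore] -/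
theorem tendsto_rpow_mul_of_succ {ε : ℕ → ℝ} {η : ℝ} (hε0 : ∀ᶠ N : ℕ in atTop, 0 ≤ ε N)
    (hε : Tendsto (fun N : ℕ => (N : ℝ) ^ (1 + η) * ε N) atTop (𝓝 0)) :
    Tendsto (fun N : ℕ => (N : ℝ) ^ η * ε N) atTop (𝓝 0) := by
  refine squeeze_zero' ?_ ?_ hε
  · filter_upwards [hε0] with N hN using mul_nonneg (Real.rpow_nonneg (Nat.cast_nonneg N) η) hN
  · filter_upwards [hε0, eventually_ge_atTop 1] with N hN hN1
    have h1 : (1 : ℝ) ≤ N := by exact_mod_cast hN1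
    exact mul_le_mul_of_nonneg_right (Real.rpow_le_rpow_of_exponent_le h1 (by linarith)) hN

/-- **THE HARMONIC PLATEAU, QUANTITATIVELY.** For the pinned harmonic chain (`ω₂, γ, T > 0`) and every `η ∈ (0,1)`:
for all large `N`, `S_N(t) ≥ T·c_∞/(2γ)` throughout the causal window `0 ≤ t ≤ N^η`, where `c_∞ = fluxLimit ω₂ γ > 0` is the
Rieder–Lebowitz–Lieb conductance. The forecast skill carried by the ballistically TRANSMITTED wave cannot be spent before the
wave reaches the far bath (corner light cone `lightConeH_of_nonneg`: `∫₀^{N^η} r_N² ≤ N^η ε_N → 0`), and it is worth at least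
`T·c_{N+1}/γ → T·c_∞/γ` of the budget (`harmonic_fnorm_ge_transmission`). This is the positive, quantitative form of
`oneTime_false_harmonic`: at `lam = β = 0` the one-time quantity `N·S_N(N^η)` grows linearly. [folklore] -/
theorem harmonic_plateau {η : ℝ} (hη0 : 0 < η) (hη1 : η < 1) :
    ∀ᶠ N : ℕ in atTop, ∀ t : ℝ, 0 ≤ t → t ≤ (N : ℝ) ^ η → T * fluxLimit ω₂ γ / (2 * γ) ≤ fnorm ω₂ 0 0 γ T N t := by
  obtain ⟨ε, hε, hwin⟩ := lightConeH_of_nonneg ω₂ 0 0 γ hω le_rfl le_rfl hγ.le T hT η hη0 hη1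
  have hP := Summit.AtomisticToContinuum.FouriersLaw.Theorems.HarmonicCoherentPersistence.harmonicCoherentPersistence_proof
    ω₂ γ hω hγ T hT
  have hε0 : ∀ N : ℕ, 0 ≤ ε N := fun N => by
    have h := hwin N 0 le_rfl (Real.rpow_nonneg (Nat.cast_nonneg N) η)
    linarith [abs_nonneg (commonPast ω₂ 0 0 γ T N 0), sq_nonneg (pairCorr ω₂ 0 0 γ T N 0)]
  -- the lower bound `T c_{N+1}/γ - (2γ/T) N^η ε_N` tends to `T c_∞/γ > T c_∞/(2γ)`
  have hc : Tendsto (fun N : ℕ => fluxCoeff ω₂ γ (N + 1)) atTop (𝓝 (fluxLimit ω₂ γ)) :=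
    (tendsto_fluxCoeff hω hγ).comp (tendsto_add_atTop_nat 1)
  have hw : Tendsto (fun N : ℕ => (N : ℝ) ^ η * ε N) atTop (𝓝 0) :=
    tendsto_rpow_mul_of_succ (Eventually.of_forall hε0) hε
  have hlim : Tendsto (fun N : ℕ => T * fluxCoeff ω₂ γ (N + 1) / γ - (2 * γ / T) * ((N : ℝ) ^ η * ε N)) atTop
      (𝓝 (T * fluxLimit ω₂ γ / γ - (2 * γ / T) * 0)) :=
    ((hc.const_mul T).div_const γ).sub (hw.const_mul _)
  rw [mul_zero, sub_zero] at hlim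
  have hpos : T * fluxLimit ω₂ γ / (2 * γ) < T * fluxLimit ω₂ γ / γ := by
    have := fluxLimit_pos hω hγ
    rw [div_lt_div_iff₀ (by positivity) hγ]
    nlinarith [mul_pos hT this]
  filter_upwards [hlim.eventually_const_lt hpos, eventually_ge_atTop 1] with N hN hN1 t ht0 htN
  have hr : IntegrableOn (fun s => (pairCorr ω₂ 0 0 γ T N s) ^ 2) (Ioi (0 : ℝ)) := hP.1 N
  -- inside the window `∫₀ᵗ r_N² ≤ t ε_N ≤ N^η ε_N`
  have hwin' : ∫ s in Ioc 0 t, (pairCorr ω₂ 0 0 γ T N s) ^ 2 ≤ (N : ℝ) ^ η * ε N := by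
    have h := norm_setIntegral_le_of_norm_le_const (μ := (volume : Measure ℝ))
      (f := fun s => (pairCorr ω₂ 0 0 γ T N s) ^ 2) (s := Ioc 0 t) (C := ε N) measure_Ioc_lt_top
      (fun s hs => by
        rw [Real.norm_eq_abs, abs_of_nonneg (sq_nonneg _)]
        have hw := hwin N s hs.1.le (hs.2.trans htN)
        linarith [abs_nonneg (commonPast ω₂ 0 0 γ T N s)])
    rw [Real.volume_real_Ioc_of_le ht0, sub_zero, Real.norm_eq_abs,
      abs_of_nonneg (setIntegral_nonneg measurableSet_Ioc fun s _ => sq_nonneg _)] at h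
    calc ∫ s in Ioc 0 t, (pairCorr ω₂ 0 0 γ T N s) ^ 2 ≤ ε N * t := h
      _ ≤ ε N * (N : ℝ) ^ η := mul_le_mul_of_nonneg_left htN (hε0 N)
      _ = (N : ℝ) ^ η * ε N := mul_comm _ _
  have hge := harmonic_fnorm_ge_transmission hω hγ hT hN1 ht0
  have hγT : 0 ≤ 2 * γ / T := by positivity
  nlinarith [mul_le_mul_of_nonneg_left hwin' hγT]

omit hω hγ hT in
/-- **Registered closed form (`harmonic_forecast_plateau`)**: the quantitative harmonic plateau. [folklore] -/
theorem harmonic_forecast_plateau : ∀ ω₂ γ : ℝ, 0 < ω₂ → 0 < γ → ∀ T : ℝ, 0 < T → ∀ η : ℝ, 0 < η → η < 1 → ∀ᶠ N : ℕ in atTop, ∀ t : ℝ, 0 ≤ t → t ≤ (N : ℝ) ^ η → T * fluxLimit ω₂ γ / (2 * γ) ≤ fnorm ω₂ 0 0 γ T N t :=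
  fun _ _ hω hγ _ hT _ hη0 hη1 => harmonic_plateau hω hγ hT hη0 hη1

end Harmonic

/-! ### Calibration: the ONE-TIME engine hypothesis is FALSE at the harmonic corner -/

/-- **The one-time engine hypothesis fails at the harmonic corner, for every `η ∈ (0,1)`.** For the pinned HARMONIC chain
`pinnedChain ω₂ 0 0 γ` (`ω₂, γ, T > 0`) it is NOT the case that `N · S_N(N^η) → 0`: by the corner-capable composition
(`oneTime_coherent_of_tailBudget_of_nonneg`: corner light cone `lightConeH_of_nonneg` inside the causal window, the
harmonic tail budget `harmonic_forecastBudget_tail` beyond it) it would close the coherent channel, `N∫₀^∞ r_N² → 0`,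
refuted by `HarmonicCoherentPersistence` (`harmonicCoherentPersistence_proof`, Rieder–Lebowitz–Lieb). So the weakest
registered form of the line's engine (p149873) genuinely uses anharmonicity — its hypothesis→conclusion chain is now
kernel-checked at `lam = β = 0` too, where the hypothesis itself is what fails (the escaped fraction of the forecast
norm plateaus). [folklore] -/
theorem oneTime_false_harmonic : ∀ ω₂ γ : ℝ, 0 < ω₂ → 0 < γ → ∀ T : ℝ, 0 < T → ∀ η : ℝ, 0 < η → η < 1 → ¬ Tendsto (fun N : ℕ => (N : ℝ) * fnorm ω₂ 0 0 γ T N ((N : ℝ) ^ η)) atTop (𝓝 0) := by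
  intro ω₂ γ hω hγ T hT η hη0 hη1 hlim
  have hP := Summit.AtomisticToContinuum.FouriersLaw.Theorems.HarmonicCoherentPersistence.harmonicCoherentPersistence_proof
    ω₂ γ hω hγ T hT
  have hint : ∀ N : ℕ, IntegrableOn (fun t => (pairCorr ω₂ 0 0 γ T N t) ^ 2) (Ioi (0 : ℝ)) := fun N => hP.1 N
  have hTail : ∀ (N : ℕ) (t₁ : ℝ), 0 ≤ t₁ →
      (2 * γ / T) * ∫ s in Ioi t₁, (pairCorr ω₂ 0 0 γ T N s) ^ 2 ≤ fnorm ω₂ 0 0 γ T N t₁ := by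
    intro N t₁ ht₁
    obtain ⟨hInt, hle⟩ := harmonic_forecastBudget_tail hω hγ hT N ht₁
    have hr : IntegrableOn (fun s => (pairCorr ω₂ 0 0 γ T N s) ^ 2) (Ioi t₁) := (hint N).mono_set (Ioi_subset_Ioi ht₁)
    have hmono : ∫ s in Ioi t₁, (pairCorr ω₂ 0 0 γ T N s) ^ 2 ≤ ∫ s in Ioi t₁, ((pairCorr ω₂ 0 0 γ T N s) ^ 2 +
        (∫ z, z.2 (Fin.last N) * fcast ω₂ 0 0 γ T N s z ∂((pinnedChain ω₂ 0 0 γ).gibbsMeasure (N + 1) T)) ^ 2) :=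
      integral_mono hr hInt fun s => le_add_of_nonneg_right (sq_nonneg _)
    have hγT : 0 ≤ 2 * γ / T := by positivity
    exact (mul_le_mul_of_nonneg_left hmono hγT).trans hle
  exact hP.2 (oneTime_coherent_of_tailBudget_of_nonneg ω₂ 0 0 γ hω le_rfl le_rfl hγ T hT hint hTail η hη0 hη1 hlim)

end Summit.AtomisticToContinuum.FouriersLaw.Theorems.PhononMeanFreePath

end
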